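import Summits.BirchSwinnertonDyer.Rank1Residual.ManinAdditive.KatoCurvePlusDefectLevers
import Summits.BirchSwinnertonDyer.BirchSwinnertonDyer.Theorems.ManinLocalTwoThreeAdditiveOfSqDvdLevel
import HarnessLib
import HarnessLib.Audit.Tags

/-!
# The non-real part of RES₃♭ IN STUB SHAPE (es g17 §2, Theorems half): `exists_isNewformOf → F-es-18♭K → E-es-61 →
# KatoCurveExists → (lattice-optimal, 9 ∣ N, no rational 3-torsion, pd₃ = 0 ⟹ 3 ∤ c)` and the law-free `p = 2` twin

Summit `BirchSwinnertonDyer`, route `ManinLocalTwoThree` (cell bsd-f2-manin), crux C3 `ManinPrimeToThreeAtNine`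
(stmt-BirchSwinnertonDyer-22968; v10 cut «stub_5ⁿ := RES₃♭ ∧ `CuspidalPlusDefectPrimeTo 3 D`», refuter-1 §R60 R-1)
and crux C2 `ManinOddAtFour` (stmt-BirchSwinnertonDyer-22967).  HAND-OVER from the cell typer (gen 12) to the C3 lead /
a p-seat: `Theorems/` is prover-only for the typer seat, and these two corollaries discharge the `E_K` side condition
«additive at `p`» by `ManinLocalTwoThree.not_good_and_not_mult_of_sq_dvd_level`, whose module lies in the route cone —
so they cannot sit in the ManinAdditive levers file.  Everything else (leaf `KatoCurvePlusDefect.lean`, proofs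
`KatoCurvePlusDefectProofs.lean` with E-es-63 `katoCurvePeriodDvdOfNoPlusDefect_holds`, levers
`KatoCurvePlusDefectLevers.lean` with `not_three_dvd_maninConstant_of_noPlusDefect'`) is filed under
`Summits/BirchSwinnertonDyer/Rank1Residual/ManinAdditive/` by the typer; the facts F-es-18♭K / F-es-21♭K are
`Literature/NumberTheory/EllipticCurves/KatoAdditiveTwistedValueNeronIntegralitySymbolClosure.lean`.  Both theorems
below are es g17's VERBATIM (HOME/es/Sketch-es-g17.lean 93557c1a115c1402 :842–883).  Suggested target:
`Theorems/ManinLocalTwoThreeKatoCurveNoPlusDefectStub.lean --supports stmt-BirchSwinnertonDyer-22968 --as helper`.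
CONDITIONAL edges; nothing about BSD or Manin's conjecture is proved.
-/

set_option autoImplicit false
-- `Summit.BirchSwinnertonDyer.BirchSwinnertonDyer` is the mandated summit-side namespace (single-conjunct summit).
set_option linter.dupNamespace false

noncomputable section

open scoped Classical MatrixGroups ModularForm ComplexConjugate

open CongruenceSubgroup Complex WeierstrassCurve Literature.NumberTheory.EllipticCurves
  Literature.NumberTheory.EllipticCurves.ModularForms
  Summit.BirchSwinnertonDyer.Rank1Residual.ManinAdditive.CuspidalKummer
  Summit.BirchSwinnertonDyer.Rank1Residual.ManinAdditive.CuspidalKummerThree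
  Summit.BirchSwinnertonDyer.Rank1Residual.ManinAdditive.KatoCurve

namespace Summit.BirchSwinnertonDyer.BirchSwinnertonDyer.Theorems.ManinLocalTwoThree

variable {W : WeierstrassCurve ℚ} {N : ℕ} [NeZero N]

/-- **THE NON-REAL PART OF RES₃♭ IN STUB SHAPE** (PROVED): modularity binder `hnf` (level = conductor), the
fact-candidate F-es-18♭K, ONE law E-es-61, ONE support S-es-K; then for every lattice-optimal `(W, D)` with `9 ∣ N`, no
rational point of order `3` on the short model and NO PLUS-DEFECT at `3` (no real cuspidal point of order `3`): `3 ∤ c`.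
The three `VK` side conditions of the `'` form are discharged by tree theorems: same newform
(`IsNewformOf.of_isIsogenous`), additive at `3` (`not_good_and_not_mult_of_sq_dvd_level`), same `L`-function
(`IsIsogenous.LFunction_eq`). -/
theorem not_three_dvd_maninConstant_of_noPlusDefect_stub
    (hnf : exists_isNewformOf)
    (hF : kato_isIntegral_twistedSymbolSum_three_symbolClosure)
    (h61 : ThreeAdicUnitWitnessOfNoRationalThreeTorsion)
    (hK : KatoCurveExists) :
    ∀ (W : WeierstrassCurve ℚ) [W.IsElliptic] [W.IsGloballyMinimal] {N : ℕ} [NeZero N]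
      (D : ModularParametrizationData W N),
      (∀ z ∈ D.L.lattice, ∃ w ∈ periodLattice D.f, z = D.c * w) → 3 ^ 2 ∣ N →
      (∀ X₀ Y₀ : ℚ, ¬ IsShortThreeTorsion W D.c X₀ Y₀) → CuspidalPlusDefectPrimeTo 3 D → ¬ (3 : ℤ) ∣ D.c := by
  intro W _ _ N _ D hopt h9 hT hpd
  obtain ⟨VK, _, _, hiso, hKC⟩ := hK W D hopt
  have hiso' : IsIsogenous VK W := hiso.symm_of_isElliptic
  have hnewK : IsNewformOf VK D.f := IsNewformOf.of_isIsogenous D.isNewformOf hiso'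
  haveI : Fact (Nat.Prime 3) := ⟨Nat.prime_three⟩
  have hadd := Summit.BirchSwinnertonDyer.BirchSwinnertonDyer.Theorems.ManinLocalTwoThree.not_good_and_not_mult_of_sq_dvd_level
    hnf hnewK h9
  have haK : ∀ ℓ : ℕ, VK.LFunction ℓ = W.LFunction ℓ := fun ℓ => by rw [hiso.LFunction_eq]
  exact not_three_dvd_maninConstant_of_noPlusDefect' hF h61 W D hopt h9 hT hpd VK hiso hKC hnewK hadd.1 hadd.2 haK

/-- The same at `p = 2` (law-free; witness hypothesis per class). -/
theorem not_two_dvd_maninConstant_of_noPlusDefect_stub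
    (hnf : exists_isNewformOf)
    (hF : kato_isIntegral_twistedSymbolSum_two_symbolClosure) (hK : KatoCurveExists) :
    ∀ (W : WeierstrassCurve ℚ) [W.IsElliptic] [W.IsGloballyMinimal] {N : ℕ} [NeZero N]
      (D : ModularParametrizationData W N),
      (∀ z ∈ D.L.lattice, ∃ w ∈ periodLattice D.f, z = D.c * w) → 2 ^ 2 ∣ N →
      CuspidalPlusDefectPrimeTo 2 D → TwoAdicPolarWitness W W D.f → ¬ (2 : ℤ) ∣ D.c := by
  intro W _ _ N _ D hopt h4 hpd hwit
  obtain ⟨VK, _, _, hiso, hKC⟩ := hK W D hopt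
  have hiso' : IsIsogenous VK W := hiso.symm_of_isElliptic
  have hnewK : IsNewformOf VK D.f := IsNewformOf.of_isIsogenous D.isNewformOf hiso'
  haveI : Fact (Nat.Prime 2) := ⟨Nat.prime_two⟩
  have hadd := Summit.BirchSwinnertonDyer.BirchSwinnertonDyer.Theorems.ManinLocalTwoThree.not_good_and_not_mult_of_sq_dvd_level
    hnf hnewK h4
  have haK : ∀ ℓ : ℕ, VK.LFunction ℓ = W.LFunction ℓ := fun ℓ => by rw [hiso.LFunction_eq]
  exact not_two_dvd_maninConstant_of_noPlusDefect_of_witness' hF W D hopt hpd hwit VK hiso hKC hnewK hadd.1 hadd.2 haK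

end Summit.BirchSwinnertonDyer.BirchSwinnertonDyer.Theorems.ManinLocalTwoThree

end
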